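import Literature.Computability.QuantumComplexity.LightCone
import HarnessLib

/-!
# Light cones are stable under dropping gates outside them

Addendum to `LightCone.lean` (`LightCone.cone gs S = (S', kept)`: the backward light cone of the
wire set `S`; `LightCone.acceptProb_eq_acceptProb_cone`: the acceptance probability of a circuit
over a unitary gate set is that of the cone of the measured wire). A simulator need not compute
the cone exactly: it may keep any SUPERSET of the cone's gates that is cut out by a predicate on
single gates — typically "all wires of the gate lie in a window `W ⊇` cone support" — because
dropping gates that the backward scan drops anyway does not change the scan:

* `LightCone.cone_filter` — if a decidable predicate `P` holds on every kept gate, then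
  `cone (gs.filter P) S = cone gs S`;
* `LightCone.acceptProb_eq_acceptProb_filter` — hence, over a unitary gate set, filtering the
  gate list by any such `P` leaves the acceptance probability unchanged (both circuits have the
  same cone); the window instance `acceptProb_eq_acceptProb_filter_subset` (`P g = (g.wires ⊆ W)`
  for any `W` containing the cone support).

## References

* M. A. Nielsen, I. L. Chuang, *Quantum Computation and Quantum Information*, CUP 2010, §4.2
  (gates outside the causal past of a measurement do not affect its statistics).
* I. L. Markov, Y. Shi, *Simulating quantum computation by contracting tensor networks*, SIAM J.
  Comput. 38 (2008) 963–981, §1 (Cor. 1.5).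
-/

noncomputable section

namespace Literature.Computability.QuantumComplexity

namespace LightCone

open _root_.Computability Cryptography

variable {G : QGateSet} {N : ℕ}

/-- The kept gates of a tail are kept gates of the whole list. [folklore] -/
theorem cone_snd_tail_subset (g : QGate G N) (gs : List (QGate G N)) (S : Finset (Fin N)) :
    (cone gs S).2 ⊆ (cone (g :: gs) S).2 := by
  by_cases h : Disjoint g.wires (cone gs S).1
  · rw [cone_cons_of_disjoint h]; exact List.Subset.refl _
  · rw [cone_cons_of_not_disjoint h]; exact List.subset_cons_self _ _

/-- **Dropping gates that the scan drops does not change the cone.** If a decidable predicate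
holds on every kept gate of the backward light cone of `S`, then the filtered gate list has the
same cone (same support, same kept gates). [folklore] -/
theorem cone_filter (P : QGate G N → Prop) [DecidablePred P] (S : Finset (Fin N)) :
    ∀ gs : List (QGate G N), (∀ g ∈ (cone gs S).2, P g) → cone (gs.filter P) S = cone gs S
  | [], _ => rfl
  | g :: gs, hP => by
    have ih := cone_filter P S gs fun g' hg' => hP g' (cone_snd_tail_subset g gs S hg')
    by_cases hPg : P g
    · rw [List.filter_cons_of_pos (by simpa using hPg)]
      by_cases h : Disjoint g.wires (cone gs S).1
      · rw [cone_cons_of_disjoint h, cone_cons_of_disjoint (by rwa [ih]), ih]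
      · rw [cone_cons_of_not_disjoint h, cone_cons_of_not_disjoint (by rwa [ih]), ih]
    · rw [List.filter_cons_of_neg (by simpa using hPg)]
      by_cases h : Disjoint g.wires (cone gs S).1
      · rw [cone_cons_of_disjoint h, ih]
      · rw [cone_cons_of_not_disjoint h] at hP
        exact absurd (hP g List.mem_cons_self) hPg

/-- **The acceptance probability is unchanged by dropping gates outside the light cone of the
measured wire**: over a unitary gate set, for any oracle, input and ancilla count, filtering the
gate list by a decidable predicate that holds on every kept gate of the cone of wire `0` gives a
circuit with the same acceptance probability. [cite: MarkovShi2008, §1 (Cor. 1.5)] -/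
theorem acceptProb_eq_acceptProb_filter {n m : ℕ} (hG : G.IsUnitary) (A : Language Bool)
    (C : QCircuit G (n + m)) (x : QReg n) (P : QGate G (n + m) → Prop) [DecidablePred P]
    (hP : ∀ h : 0 < n + m, ∀ g ∈ (cone C.gates {⟨0, h⟩}).2, P g) :
    C.acceptProb A x = (⟨C.gates.filter P⟩ : QCircuit G (n + m)).acceptProb A x := by
  by_cases h : 0 < n + m
  · rw [acceptProb_eq_acceptProb_cone hG A C x h, acceptProb_eq_acceptProb_cone hG A ⟨C.gates.filter P⟩ x h]
    simp only
    rw [cone_filter P _ C.gates (hP h)]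
  · unfold QCircuit.acceptProb
    simp [h]

/-- **Window form.** If `W` contains the cone support of wire `0`, keeping exactly the gates with
all wires in `W` does not change the acceptance probability (every kept gate of the cone acts
inside the cone support, `wires_subset_cone`). [cite: MarkovShi2008, §1 (Cor. 1.5)] -/
theorem acceptProb_eq_acceptProb_filter_subset {n m : ℕ} (hG : G.IsUnitary) (A : Language Bool)
    (C : QCircuit G (n + m)) (x : QReg n) (W : Finset (Fin (n + m)))
    (hW : ∀ h : 0 < n + m, (cone C.gates {⟨0, h⟩}).1 ⊆ W) :
    C.acceptProb A x = (⟨C.gates.filter fun g => g.wires ⊆ W⟩ : QCircuit G (n + m)).acceptProb A x :=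
  acceptProb_eq_acceptProb_filter hG A C x (fun g => g.wires ⊆ W) fun h g hg =>
    (wires_subset_cone C.gates {⟨0, h⟩} g hg).trans (hW h)

end LightCone

end Literature.Computability.QuantumComplexity

end
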